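import Summits.AnomalousDissipation.AnomalousDissipation.Theorems.ImpulseGridGridThesisStubNoReversalOfSubthresholdWake

/-!
# Route ImpulseGrid (AnomalousDissipation) — no reversal of a sub-threshold wake, pressure-free

Stub `stub_noReversalOfSubthresholdWakeNoPressure` (W6′) of the line `Sketch` of the crux
`Summit.AnomalousDissipation.AnomalousDissipation.Theses.ImpulseGrid.GridThesis`
(item `stmt-AnomalousDissipation-1770`): the pressure-free restatement of the barrier lemma behind
clause (a) NO REVERSAL (`stub_noReversalOfSubthresholdWake`,
`Theorems/ImpulseGridGridThesisStubNoReversalOfSubthresholdWake.lean`). The landed statement carries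
three hypotheses on a steady-Euler pressure `q` (`q` smooth, `x₀`-invariant, `(G·∇)G = ∇q`) which
its proof never uses; here they are dropped from the signature, so that the composition no longer
has to exhibit such a pressure for the cellular pattern.

For the slab⊗transverse force `Φ•G` (`G` smooth, `x₀`-invariant, `G₀ ≡ 0`, divergence free, a
Stokes eigenfield `ΔG = -λG`, with the strain bound `|⟪ξ,(ξ·∇)G⟫| ≤ σ‖ξ‖²`), a global Leray–Hopf
solution `u` with datum `u₀`, `∫u₀ = c e₀`, aligned initial imprint `(G,u₀) ≥ 0`, and the
sub-threshold energy condition `σ(2·KE(u(t)) − c²) ≤ (Φ•G, G)` whenever `(G,u(t)) ≤ 0`, the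
imprint `a(t) = (G, u(t))` never becomes negative (`t > 0`).

Proof: verbatim the landed one. `a(t) − a(s) = ∫ₛᵗ flux` (time-sliced weak formulation,
`Torus.IsLerayHopfOn.integral_inner_sub_eq_setIntegral`), `flux = T_G + ν(u,ΔG) + (Φ•G,G)`; the
exact production bound `T_G ≥ −σ(∫‖u‖² − m²) ≥ −σ(2·KE(u) − c²)`
(`NoReversal.neg_mul_le_integral_inner_convect`, conserved momentum
`NoReversal.integral_inner_const_eq_datum`, `NoReversal.sq_le_sq_of_integral_eq_smul`), so
`flux ≥ −νλ a ≥ 0` while `a ≤ 0`, and `NoReversal.nonneg_of_barrier` applied to the continuous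
extension `NoReversal.continuous_pairingExtension` of `a` by `(G,u₀)` concludes.

References: R. Temam, *Navier–Stokes Equations* (1984), Ch. III §1.1 (1.25); C. Foias, O. Manley,
R. Rosa, R. Temam, *Navier–Stokes Equations and Turbulence* (2001), Ch. II App. A, Ch. IV §3.1.
-/

noncomputable section

-- `Summit.<Summit>.<Problem>` is the tree's mandated summit-side namespace (CONVENTIONS §2); for
-- this single-conjunct summit the two coincide, so the duplicate is deliberate.
set_option linter.dupNamespace false

open MeasureTheory Set Filter Topology
open scoped InnerProductSpace RealInnerProductSpace

namespace Summit.AnomalousDissipation.AnomalousDissipation.Theorems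

open Literature.Analysis.FluidPDE Literature.Analysis.FluidPDE.Torus
open Literature.Analysis.FunctionSpaces Literature.Analysis.FunctionSpaces.Torus

-- adapted from Theorems/ImpulseGridGridThesisStubNoReversalOfSubthresholdWake.lean
-- (`stub_noReversalOfSubthresholdWake`, the same proof with the three `q`-binders removed)
/-- **Stub `stub_noReversalOfSubthresholdWakeNoPressure` (W6′, line `Sketch` of crux `GridThesis`,
item stmt-AnomalousDissipation-1770): no reversal of a sub-threshold wake, pressure-free form.**
For the grid design (`G` smooth, `x₀`-invariant, `G₀ ≡ 0`, divergence free, `ΔG = −λG`, strain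
bound `σ`) and a global Leray–Hopf solution driven by the mean-zero force `Φ•G` with drift datum
`∫u₀ = c e₀`, aligned initial imprint `(G,u₀) ≥ 0` and the sub-threshold condition
`(G,u(t)) ≤ 0 ⇒ σ(2·KE(u(t)) − c²) ≤ (Φ•G, G)` (`t > 0`), the imprint `(G,u(t))` is `≥ 0` for all
`t > 0`: `a(t) − a(s) = ∫ₛᵗ (T_G − νλ a + (Φ•G,G))` (time-sliced weak formulation), the exact
production bound `T_G ≥ −σ(2·KE − c²)` (`NoReversal.neg_mul_le_integral_inner_convect` with the
conserved momentum), so the flux is `≥ 0` while `a ≤ 0`, and the barrier lemma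
`NoReversal.nonneg_of_barrier` applies to the continuous extension of `a` by `(G,u₀)` at `t ≤ 0`.
No steady-Euler pressure is assumed; the sup-energy bound is not used. [folklore] -/
theorem stub_noReversalOfSubthresholdWakeNoPressure :
    ∀ (ν lam σ c : ℝ) (Φ : UnitAddTorus (Fin 3) → ℝ)
      (G u₀ : UnitAddTorus (Fin 3) → EuclideanSpace ℝ (Fin 3))
      (u : ℝ → UnitAddTorus (Fin 3) → EuclideanSpace ℝ (Fin 3)),
      0 ≤ ν * lam → 0 ≤ σ →
      IsSmooth G → (∀ (s : UnitAddCircle) x, G (x + Pi.single (0 : Fin 3) s) = G x) →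
      (∀ x, G x 0 = 0) → IsDivFree G → (∀ x, laplacian G x = -(lam • G x)) →
      (∀ x (ξ : EuclideanSpace ℝ (Fin 3)), |⟪ξ, convect (fun _ => ξ) G x⟫| ≤ σ * ‖ξ‖ ^ 2) →
      IsSmooth (fun x => Φ x • G x) → HasZeroMean (fun x => Φ x • G x) →
      IsGlobalLerayHopf ν (fun _ => fun x => Φ x • G x) u₀ u →
      (∃ C₀ : ℝ, ∀ t : ℝ, 0 ≤ t → kineticEnergy (u t) ≤ C₀) →
      (∫ x, u₀ x = c • EuclideanSpace.single 0 1) →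
      (0 ≤ ∫ x, ⟪G x, u₀ x⟫) →
      (∀ t : ℝ, 0 < t → (∫ x, ⟪G x, u t x⟫) ≤ 0 →
        σ * (2 * kineticEnergy (u t) - c ^ 2) ≤ ∫ x, ⟪Φ x • G x, G x⟫) →
      ∀ t : ℝ, 0 < t → 0 ≤ ∫ x, ⟪G x, u t x⟫ := by
  intro ν lam σ c Φ G u₀ u hνl hσ hG hGinv hG0 hGdiv hΔG hstrain hfs hfmean hu _hsup hdrift hal
    hthr
  have hcomm : ∀ v : UnitAddTorus (Fin 3) → EuclideanSpace ℝ (Fin 3),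
      (∫ x, ⟪G x, v x⟫) = ∫ x, ⟪v x, G x⟫ := fun v =>
    integral_congr_ae (ae_of_all _ fun x => real_inner_comm _ _)
  have hF : MemLp (fun x => Φ x • G x) 2 volume := hfs.memLp 2
  have hdG : ∀ y, partialDeriv 0 G y = 0 :=
    GridInjection.partialDeriv_eq_zero_of_forall_add_single hGinv
  -- the conserved `e₀`-momentum `m`, `c² ≤ m²`
  have hmom : ∀ τ : ℝ, 0 < τ → ∫ x, ⟪u τ x, EuclideanSpace.single 0 1⟫ =
      ∫ x, ⟪u₀ x, EuclideanSpace.single 0 1⟫ := fun τ hτ =>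
    NoReversal.integral_inner_const_eq_datum hfs hfmean hu _ hτ
  have hcm : c ^ 2 ≤ (∫ x, ⟪u₀ x, EuclideanSpace.single 0 1⟫) ^ 2 :=
    NoReversal.sq_le_sq_of_integral_eq_smul hdrift
  -- the flux is non-negative while the imprint is non-positive
  have hflux : ∀ τ : ℝ, 0 < τ → (∫ x, ⟪u τ x, G x⟫) ≤ 0 →
      0 ≤ trajFlux ν (fun x => Φ x • G x) u G τ := by
    intro τ hτ ha
    rw [GridInjection.trajFlux_eq_of_nonneg hF hu hG hτ.le]
    have h1 := NoReversal.neg_mul_le_integral_inner_convect hG hG0 hdG hstrain (hu.memLp_two hτ.le)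
      (hmom τ hτ)
    have h2 : ∫ x, ⟪u τ x, laplacian G x⟫ = -(lam * ∫ x, ⟪u τ x, G x⟫) := by
      rw [← integral_const_mul, ← integral_neg]
      refine integral_congr_ae (ae_of_all _ fun x => ?_)
      show ⟪u τ x, laplacian G x⟫ = -(lam * ⟪u τ x, G x⟫)
      rw [hΔG x, inner_neg_right, real_inner_smul_right]
    have h3 := hthr τ hτ (by rw [hcomm (u τ)]; exact ha)
    have hKE : kineticEnergy (u τ) = 2⁻¹ * ∫ x, ‖u τ x‖ ^ 2 := rfl
    rw [hKE] at h3
    rw [h2]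
    linarith [mul_nonneg hνl (neg_nonneg.2 ha), mul_le_mul_of_nonneg_left hcm hσ]
  -- increments of the imprint are integrals of the flux (time-sliced weak formulation)
  have hinc : ∀ s t : ℝ, 0 < s → s ≤ t →
      (∫ x, ⟪u t x, G x⟫) - (∫ x, ⟪u s x, G x⟫) =
        ∫ τ in Ioc s t, trajFlux ν (fun x => Φ x • G x) u G τ :=
    fun s t hs hst => (hu t (hs.trans_le hst)).integral_inner_sub_eq_setIntegral (hs.trans_le hst)
      (aestronglyMeasurable_stLift_const hfs _) (lintegral_enorm_sq_const_lt_top hfs t) hG hGdiv hs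
      hst le_rfl
  -- the continuous extension of the imprint by `(u₀, G)` at `t ≤ 0`
  obtain ⟨a, ha_cont, ha_pos, ha_zero⟩ : ∃ a : ℝ → ℝ, Continuous a ∧
      (∀ t, 0 < t → a t = ∫ x, ⟪u t x, G x⟫) ∧ a 0 = ∫ x, ⟪u₀ x, G x⟫ :=
    ⟨fun t => if 0 < t then ∫ x, ⟪u t x, G x⟫ else ∫ x, ⟪u₀ x, G x⟫,
      NoReversal.continuous_pairingExtension hu (hG.memLp 2), fun t ht => if_pos ht,
      if_neg (lt_irrefl 0)⟩
  have ha0 : 0 ≤ a 0 := by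
    rw [ha_zero, ← hcomm u₀]
    exact hal
  have hmono : ∀ s t : ℝ, 0 ≤ s → s ≤ t → (∀ τ ∈ Icc s t, a τ < 0) → a s ≤ a t := by
    intro s t hs hst hneg
    have hs' : 0 < s := by
      rcases hs.eq_or_lt with h | h
      · exact absurd (h ▸ ha0) (not_le.2 (hneg s ⟨le_rfl, hst⟩))
      · exact h
    have ht' : 0 < t := hs'.trans_le hst
    rw [ha_pos s hs', ha_pos t ht', ← sub_nonneg, hinc s t hs' hst]
    refine setIntegral_nonneg measurableSet_Ioc fun τ hτ => ?_
    have hτ0 : 0 < τ := hs'.trans hτ.1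
    have hτa := hneg τ ⟨hτ.1.le, hτ.2⟩
    rw [ha_pos τ hτ0] at hτa
    exact hflux τ hτ0 hτa.le
  -- conclusion
  intro t ht
  have h := NoReversal.nonneg_of_barrier ha_cont ha0 hmono t ht.le
  rw [ha_pos t ht] at h
  rw [hcomm (u t)]
  exact h

end Summit.AnomalousDissipation.AnomalousDissipation.Theorems

end
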